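import Literature.MathematicalPhysics.QuantumLattice.KomaPiFluxCoulombInfraredBound
import Literature.MathematicalPhysics.QuantumLattice.KomaPiFluxKLSInequality
import HarnessLib

/-!
# Koma's KLS inequality with the Coulomb repulsion (Koma 2022, §6 and §8)

T. Koma, *Nambu–Goldstone modes for superconducting lattice fermions*, arXiv:2201.13135 (2022)
[Koma2022], §8: the nearest-neighbour Coulomb repulsion `H_repul = g' Σ_{bonds} Γ³_xΓ³_y` ((2.6),
(8.1)) is added to the `π`-flux BCS Hamiltonian.  Koma remarks (§8) that the argument of §5–§6 goes
through: reflection positivity ((8.4), `KomaPiFlux.partitionFn_le_coulomb`), the infrared bound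
(`KomaPiFlux.gibbs_modes_le_coulomb`), and the long-range-order inequality (6.24)/(6.34), where the
Coulomb term only enlarges the double commutator (6.25)–(6.33) by a term of order `g'`.

This file carries out the double-commutator and KLS steps with `g' ≥ 0` (Lieb frame, field `h = 0`):

* `PairHopRP.coulomb_comm_gammaOne` — `[H_repul(g'), Γ¹_x] = 2ig' Σ_{y∼x} Γ²_xΓ³_y` (from (3.10));
* `PairHopRP.gammaOne_doubleComm_coulomb` — `[Γ¹_x, [H_repul(g'), Γ¹_x]] = -4g' Σ_{y∼x} Γ³_xΓ³_y`, and
  `PairHopRP.gammaOne_doubleComm_hamiltonianC` — the local double commutator of `H(T,U;g,g',h;B)`;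
* `PairHopRP.etaRot_coulomb`, `PairHopRP.etaRot_hamiltonianC_zero`,
  `PairHopRP.gibbsState_gammaOne_mul_eq_coulomb` — the `η`-rotation (3.11) fixes `Γ³`, hence `H_repul`,
  so `⟨Γ¹_xΓ¹_y⟩ = ⟨Γ²_xΓ²_y⟩` persists at `h = 0`, `B = 0`;
* `KomaPiFlux.neg_one_le_re_gibbsState_gammaThree_mul` — `Re⟨Γ³_xΓ³_y⟩ ≥ -1`;
* `KomaPiFlux.doubleComm_modes_sum_le_coulomb` — (6.33) with the Coulomb term:
  `Σ_p (c(C_p) + c(S_p)) ≤ (8κ + 4g + 8g')(d+1)|Λ|²`;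
* `KomaPiFlux.koma_kls_coulomb` — Koma's inequality (6.34) for `H(κ,U;g,g',0;0)`, with `8(d+1)κ|Λ|`
  replaced by `8(d+1)(κ+g')|Λ|` in the double-commutator factor.

All statements are PROVED; no named fact.

## References

* [Koma2022] T. Koma, arXiv:2201.13135, (2.6), (3.10)–(3.11), (6.15)–(6.34), §8 (8.1)–(8.4).
* [KLS1988PRL] T. Kennedy, E. H. Lieb, B. S. Shastry, Phys. Rev. Lett. 61 (1988) 2582, eqs. (5)–(7).
* [DLS1978] F. J. Dyson, E. H. Lieb, B. Simon, J. Stat. Phys. 18 (1978) 335, Thms. 3.1–3.2.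
-/

noncomputable section

namespace Literature.MathematicalPhysics.QuantumLattice

open Matrix Finset HubbardWave0

namespace PairHopRP

variable {Λ : Type*} [LinearOrder Λ] [Fintype Λ]

/-! ### `Γ³` algebra -/

/-- `Γ³_x` and `Γ³_y` commute (they are polynomials in the number operators). [cite: Koma2022, (3.9)] -/
theorem gammaThree_commute (x y : Λ) : Commute (gammaThree x) (gammaThree y) := by
  have hn : ∀ σ τ : Fin 2, Commute (numberOp x σ) (numberOp y τ) := fun σ τ =>
    numberAt_commute (orb x σ) (orb y τ)
  have h : ∀ σ : Fin 2, Commute (numberOp x σ) (gammaThree y) := fun σ =>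
    ((Commute.one_right _).sub_right (hn σ 0)).sub_right (hn σ 1)
  exact ((Commute.one_left _).sub_left (h 0)).sub_left (h 1)

/-- `1 - (Γ³_x)² = (n_{x↑} - n_{x↓})²` (so `0 ≤ (Γ³_x)² ≤ 1`). [cite: Koma2022, (3.9)] -/
theorem one_sub_gammaThree_sq (x : Λ) :
    1 - gammaThree x * gammaThree x = (numberOp x 0 - numberOp x 1) * (numberOp x 0 - numberOp x 1) := by
  have h0 : numberOp x 0 * numberOp x 0 = numberOp x 0 := (numberAt_idempotent (orb x 0)).eq
  have h1 : numberOp x 1 * numberOp x 1 = numberOp x 1 := (numberAt_idempotent (orb x 1)).eq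
  have hc : numberOp x 1 * numberOp x 0 = numberOp x 0 * numberOp x 1 := (numberAt_commute (orb x 1) (orb x 0)).eq
  simp only [gammaThree, Matrix.sub_mul, Matrix.mul_sub, Matrix.one_mul, Matrix.mul_one, h0, h1, hc]
  abel

/-! ### `[H_repul, Γ¹_x]` and the double commutator -/

section Graph

variable (G : SimpleGraph Λ) [DecidableRel G.Adj]

/-- Bookkeeping: a double sum whose terms vanish off the "cross" `{a = x} ∪ {b = x}` and at `(x,x)`
is the sum over the cross. [folklore] -/
private theorem sum_sum_eq_cross' {M : Type*} [AddCommMonoid M] (C : Λ → Λ → M) (x : Λ)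
    (h0 : ∀ a b, a ≠ x → b ≠ x → C a b = 0) (hxx : C x x = 0) :
    ∑ a, ∑ b, C a b = ∑ y, (C x y + C y x) := by
  rw [Finset.sum_add_distrib, ← Finset.add_sum_erase _ _ (Finset.mem_univ x)]
  congr 1
  rw [← Finset.add_sum_erase univ (fun a => C a x) (Finset.mem_univ x), hxx, zero_add]
  refine Finset.sum_congr rfl fun a ha => ?_
  have hax : a ≠ x := Finset.ne_of_mem_erase ha
  exact Finset.sum_eq_single x (fun b _ hb => h0 a b hax hb) (fun h => absurd (Finset.mem_univ x) h)

omit [DecidableRel G.Adj] in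
/-- `Γ¹_x` commutes with the Coulomb bond operators of bonds not containing `x`. [cite: Koma2022, (3.10), (8.1)] -/
theorem commute_gammaOne_coulombBond {x a b : Λ} (ha : a ≠ x) (hb : b ≠ x) (g' : ℝ) :
    Commute (gammaOne x) (coulombBond g' a b) := by
  have h3a : Commute (gammaOne x) (gammaThree a) := (gammaThree_comm_gammaOne_of_ne ha).symm
  have h3b : Commute (gammaOne x) (gammaThree b) := (gammaThree_comm_gammaOne_of_ne hb).symm
  unfold coulombBond
  exact (h3a.mul_right h3b).smul_right _

omit [DecidableRel G.Adj] in
/-- The commutator of one Coulomb bond term at `x`: `[(g'/2)Γ³_xΓ³_y, Γ¹_x] = ig' Γ²_xΓ³_y` for `y ≠ x`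
(from `[Γ³_x, Γ¹_x] = 2iΓ²_x`, (3.10)). [cite: Koma2022, (3.10), (8.1)] -/
theorem coulombBond_comm_gammaOne {x y : Λ} (hyx : y ≠ x) (g' : ℝ) :
    coulombBond g' x y * gammaOne x - gammaOne x * coulombBond g' x y =
      ((Complex.I * g' : ℂ)) • (gammaTwo x * gammaThree y) := by
  have e : gammaThree x * gammaThree y * gammaOne x - gammaOne x * (gammaThree x * gammaThree y) =
      (gammaThree x * gammaOne x - gammaOne x * gammaThree x) * gammaThree y := by
    simp only [Matrix.sub_mul, Matrix.mul_assoc]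
    rw [gammaThree_comm_gammaOne_of_ne hyx]
  rw [coulombBond, Matrix.smul_mul, Matrix.mul_smul, ← smul_sub, e, gammaThree_comm_gammaOne, Matrix.smul_mul,
    smul_smul]
  congr 1
  push_cast
  ring

/-- **`[H_repul(g'), Γ¹_x] = 2ig' Σ_{y∼x} Γ²_x Γ³_y`**. [cite: Koma2022, (3.10), (8.1), §8] -/
theorem coulomb_comm_gammaOne (g' : ℝ) (x : Λ) :
    coulomb G g' * gammaOne x - gammaOne x * coulomb G g' =
      ((Complex.I * (2 * g') : ℂ)) • ∑ y : Λ, if G.Adj x y then gammaTwo x * gammaThree y else 0 := by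
  unfold coulomb
  rw [Finset.sum_mul, Finset.mul_sum, ← Finset.sum_sub_distrib]
  simp only [Finset.sum_mul, Finset.mul_sum, ← Finset.sum_sub_distrib]
  rw [sum_sum_eq_cross' (fun a b => (if G.Adj a b then coulombBond g' a b else 0) * gammaOne x -
      gammaOne x * (if G.Adj a b then coulombBond g' a b else 0)) x]
  · rw [Finset.smul_sum]
    refine Finset.sum_congr rfl fun y _ => ?_
    by_cases hxy : G.Adj x y
    · have hyx : y ≠ x := fun h => G.irrefl (h ▸ hxy)
      have hswap : coulombBond g' y x = coulombBond g' x y := by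
        rw [coulombBond, coulombBond, (gammaThree_commute y x).eq]
      simp only [if_pos hxy, if_pos hxy.symm]
      rw [hswap, coulombBond_comm_gammaOne hyx, ← two_smul ℂ, smul_smul]
      congr 1
      ring
    · simp only [if_neg hxy, if_neg (fun h : G.Adj y x => hxy h.symm), Matrix.zero_mul, Matrix.mul_zero, sub_zero,
        add_zero, smul_zero]
  · intro a b ha hb
    split_ifs
    · exact sub_eq_zero.2 (commute_gammaOne_coulombBond ha hb g').eq.symm
    · rw [Matrix.zero_mul, Matrix.mul_zero, sub_zero]
  · rw [if_neg G.irrefl, Matrix.zero_mul, Matrix.mul_zero, sub_zero]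

/-- **The local double commutator of the Coulomb term**:
`[Γ¹_x, [H_repul(g'), Γ¹_x]] = -4g' Σ_{y∼x} Γ³_x Γ³_y` (from `[Γ¹_x, Γ²_x] = 2iΓ³_x`). Its expectation is
bounded by `4g'·(2d)` per site, the `O(g')` enlargement of (6.33) announced in §8. [cite: Koma2022, (3.8), (6.33), §8] -/
theorem gammaOne_doubleComm_coulomb (g' : ℝ) (x : Λ) :
    gammaOne x * (coulomb G g' * gammaOne x - gammaOne x * coulomb G g') -
        (coulomb G g' * gammaOne x - gammaOne x * coulomb G g') * gammaOne x =
      ((-(4 * g') : ℝ) : ℂ) • ∑ y : Λ, if G.Adj x y then gammaThree x * gammaThree y else 0 := by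
  rw [coulomb_comm_gammaOne, Matrix.mul_smul, Matrix.smul_mul, ← smul_sub, Finset.mul_sum, Finset.sum_mul,
    ← Finset.sum_sub_distrib]
  have hpt : ∀ y : Λ, gammaOne x * (if G.Adj x y then gammaTwo x * gammaThree y else 0) -
      (if G.Adj x y then gammaTwo x * gammaThree y else 0) * gammaOne x =
      if G.Adj x y then (2 * Complex.I) • (gammaThree x * gammaThree y) else 0 := by
    intro y
    split_ifs with hxy
    · have hyx : y ≠ x := fun h => G.irrefl (h ▸ hxy)
      rw [← Matrix.mul_assoc, gammaOne_mul_gammaTwo, Matrix.mul_assoc, gammaThree_comm_gammaOne_of_ne hyx,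
        ← Matrix.mul_assoc, gammaTwo_mul_gammaOne, Matrix.smul_mul, Matrix.smul_mul]
      module
    · rw [Matrix.mul_zero, Matrix.zero_mul, sub_zero]
  simp only [hpt]
  rw [Finset.smul_sum, Finset.smul_sum]
  refine Finset.sum_congr rfl fun y _ => ?_
  split_ifs
  · rw [smul_smul]
    congr 1
    push_cast
    linear_combination (4 * (g' : ℂ)) * Complex.I_mul_I
  · rw [smul_zero, smul_zero]

/-- **The local double commutator of `H(T,U;g,g',h;B)`** splits as that of `H(T,U;g,h;B)` plus
`-4g' Σ_{y∼x} Γ³_xΓ³_y`. [cite: Koma2022, (6.25)–(6.29), §8] -/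
theorem gammaOne_doubleComm_hamiltonianC (T : Fin 2 → Λ → Λ → ℂ) (U g g' : ℝ) (h : Λ → Λ → ℝ) (B : ℝ) (x : Λ) :
    gammaOne x * (hamiltonianC G T U g g' h B * gammaOne x - gammaOne x * hamiltonianC G T U g g' h B) -
        (hamiltonianC G T U g g' h B * gammaOne x - gammaOne x * hamiltonianC G T U g g' h B) * gammaOne x =
      (gammaOne x * (hamiltonian G T U g h B * gammaOne x - gammaOne x * hamiltonian G T U g h B) -
          (hamiltonian G T U g h B * gammaOne x - gammaOne x * hamiltonian G T U g h B) * gammaOne x) +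
        ((-(4 * g') : ℝ) : ℂ) • ∑ y : Λ, if G.Adj x y then gammaThree x * gammaThree y else 0 := by
  rw [← gammaOne_doubleComm_coulomb G g' x, hamiltonianC]
  simp only [Matrix.mul_add, Matrix.add_mul, Matrix.mul_sub, Matrix.sub_mul]
  abel

/-! ### The `η`-rotation symmetry with the Coulomb term -/

omit [DecidableRel G.Adj] in
/-- The quarter `η`-rotation fixes `Γ³_x` (it is an orbital gauge). [cite: Koma2022, (3.11)] -/
theorem etaRot_gammaThree (x : Λ) : etaRot (gammaThree x) = gammaThree x := by
  rw [etaRot_apply]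
  exact orbitalPhaseAut_gammaThree (fun σ x => norm_etaRotPhase σ x) x

/-- The quarter `η`-rotation fixes `H_repul`. [cite: Koma2022, (3.11), (8.1)] -/
theorem etaRot_coulomb (g' : ℝ) : etaRot (coulomb G g') = coulomb G g' := by
  rw [etaRot_apply]
  exact orbitalPhaseAut_coulomb G (fun σ x => norm_etaRotPhase σ x) g'

/-- **`W H(T,U;g,g',0;0) Wᴴ = H(T,U;g,g',0;0)`**: at zero symmetry-breaking fields the Hamiltonian with
the Coulomb term is invariant under the quarter `η`-rotation. [cite: Koma2022, (3.11), §8] -/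
theorem etaRot_hamiltonianC_zero (T : Fin 2 → Λ → Λ → ℂ) (U g g' : ℝ) :
    etaRot (hamiltonianC G T U g g' (fun _ _ => 0) 0) = hamiltonianC G T U g g' (fun _ _ => 0) 0 := by
  rw [hamiltonianC, map_add, etaRot_hamiltonian_zero, etaRot_coulomb]

/-- **`⟨Γ¹_x Γ¹_y⟩ = ⟨Γ²_x Γ²_y⟩` at `h = 0`, `B = 0`** with the Coulomb term. [cite: Koma2022, (3.11), App. B, §8] -/
theorem gibbsState_gammaOne_mul_eq_coulomb (β : ℝ) (T : Fin 2 → Λ → Λ → ℂ) (U g g' : ℝ) (x y : Λ) :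
    gibbsState β (hamiltonianC G T U g g' (fun _ _ => 0) 0) (gammaOne x * gammaOne y) =
      gibbsState β (hamiltonianC G T U g g' (fun _ _ => 0) 0) (gammaTwo x * gammaTwo y) := by
  rw [← gibbsState_etaRot β (etaRot_hamiltonianC_zero G T U g g') (gammaOne x * gammaOne y), map_mul,
    etaRot_gammaOne, etaRot_gammaOne, neg_mul_neg]

/-- `⟨Γ²_x⟩ = 0` at `h = 0`, `B = 0` with the Coulomb term. [cite: Koma2022, (3.11), §8] -/
theorem gibbsState_gammaTwo_eq_zero_coulomb (β : ℝ) (T : Fin 2 → Λ → Λ → ℂ) (U g g' : ℝ) (x : Λ) :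
    gibbsState β (hamiltonianC G T U g g' (fun _ _ => 0) 0) (gammaTwo x) = 0 := by
  have h1 := gibbsState_etaRot β (etaRot_hamiltonianC_zero G T U g g') (gammaTwo x)
  have h2 := gibbsState_etaRot β (etaRot_hamiltonianC_zero G T U g g') (gammaOne x)
  rw [etaRot_gammaTwo] at h1
  rw [etaRot_gammaOne, map_neg] at h2
  have : gibbsState β (hamiltonianC G T U g g' (fun _ _ => 0) 0) (gammaTwo x) =
      -gibbsState β (hamiltonianC G T U g g' (fun _ _ => 0) 0) (gammaTwo x) := by rw [h2, h1]
  exact CharZero.eq_neg_self_iff.mp this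

end Graph

end PairHopRP

/-! ### The bound (6.33) and the KLS inequality (6.34) with the Coulomb term -/

open PairHopRP FermionTorus LiebCutRP
open Literature.Probability.LatticeModels
open scoped ComplexOrder

namespace KomaPiFlux

attribute [local instance] LiebCutRP.decEqTorus

variable {d L : ℕ} [NeZero L]

omit [NeZero L] in
/-- `Re⟨(Γ³_x)²⟩ ≤ 1` in any Gibbs state. [cite: Koma2022, (3.9)] [cite: BratteliRobinson1997, §5.3.1] -/
theorem re_gibbsState_gammaThree_sq_le_one (β : ℝ)
    {H : Matrix (Finset (Orb (FermionTorus (d + 1) L))) (Finset (Orb (FermionTorus (d + 1) L))) ℂ} (hH : H.IsHermitian)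
    (x : FermionTorus (d + 1) L) : (gibbsState β H (gammaThree x * gammaThree x)).re ≤ 1 := by
  have hn : ∀ σ : Fin 2, (numberOp x σ)ᴴ = numberOp x σ := fun σ => by
    rw [numberOp]; exact (numberAt_isHermitian (orb x σ)).eq
  have hA : (1 - gammaThree x * gammaThree x).PosSemidef := by
    rw [PairHopRP.one_sub_gammaThree_sq]
    have h : (numberOp x 0 - numberOp x 1)ᴴ = numberOp x 0 - numberOp x 1 := by rw [conjTranspose_sub, hn, hn]
    nth_rw 1 [← h]
    exact Matrix.posSemidef_conjTranspose_mul_self _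
  have h0 := (Complex.nonneg_iff.mp (gibbsState_nonneg_of_posSemidef β hH hA)).1
  rw [map_sub, Complex.sub_re, gibbsState_one β H (partitionFn_pos β hH).ne', Complex.one_re] at h0
  linarith

omit [NeZero L] in
/-- **`Re⟨Γ³_x Γ³_y⟩ ≥ -1`** in any Gibbs state (`(Γ³_x + Γ³_y)² ≥ 0` and `⟨(Γ³)²⟩ ≤ 1`).
[cite: Koma2022, (6.33), §8] [cite: BratteliRobinson1997, §5.3.1] -/
theorem neg_one_le_re_gibbsState_gammaThree_mul (β : ℝ)
    {H : Matrix (Finset (Orb (FermionTorus (d + 1) L))) (Finset (Orb (FermionTorus (d + 1) L))) ℂ} (hH : H.IsHermitian)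
    (x y : FermionTorus (d + 1) L) : -1 ≤ (gibbsState β H (gammaThree x * gammaThree y)).re := by
  have hx := re_gibbsState_gammaThree_sq_le_one β hH x
  have hy := re_gibbsState_gammaThree_sq_le_one β hH y
  have hA : ((gammaThree x + gammaThree y)ᴴ * (gammaThree x + gammaThree y)).PosSemidef :=
    Matrix.posSemidef_conjTranspose_mul_self _
  have h0 := (Complex.nonneg_iff.mp (gibbsState_nonneg_of_posSemidef β hH hA)).1
  rw [conjTranspose_add, (PairHopRP.gammaThree_isHermitian x).eq, (PairHopRP.gammaThree_isHermitian y).eq,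
    Matrix.add_mul, Matrix.mul_add, Matrix.mul_add, (PairHopRP.gammaThree_commute y x).eq, map_add, map_add, map_add,
    Complex.add_re, Complex.add_re, Complex.add_re] at h0
  linarith

/-- **`Σ_x Re⟨[Γ¹_x,[H_C,Γ¹_x]]⟩ = Σ_x Re⟨[Γ¹_x,[H,Γ¹_x]]⟩ - 4g' Σ_x Σ_{y∼x} Re⟨Γ³_xΓ³_y⟩`** for
`H_C = H(κ,U;g,g',h;B)`, `H = H(κ,U;g,h;B)`, in the Gibbs state of any `H'`. [cite: Koma2022, (6.25)–(6.29), §8] -/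
theorem sum_dcKernel_diag_hamiltonianC_eq (β : ℝ)
    (H' : Matrix (Finset (Orb (FermionTorus (d + 1) L))) (Finset (Orb (FermionTorus (d + 1) L))) ℂ)
    (κ U g g' : ℝ) (h : FermionTorus (d + 1) L → FermionTorus (d + 1) L → ℝ) (B : ℝ) :
    ∑ x : FermionTorus (d + 1) L, (gibbsState β H'
        (gammaOne x * (hamiltonianC κ U g g' h B * gammaOne x - gammaOne x * hamiltonianC κ U g g' h B) -
          (hamiltonianC κ U g g' h B * gammaOne x - gammaOne x * hamiltonianC κ U g g' h B) * gammaOne x)).re =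
      ∑ x : FermionTorus (d + 1) L, (gibbsState β H'
        (gammaOne x * (hamiltonian κ U g h B * gammaOne x - gammaOne x * hamiltonian κ U g h B) -
          (hamiltonian κ U g h B * gammaOne x - gammaOne x * hamiltonian κ U g h B) * gammaOne x)).re +
      -(4 * g') * ∑ x : FermionTorus (d + 1) L, ∑ y : FermionTorus (d + 1) L,
        (if (G d L).Adj x y then (gibbsState β H' (gammaThree x * gammaThree y)).re else 0) := by
  unfold hamiltonianC hamiltonian
  simp_rw [PairHopRP.gammaOne_doubleComm_hamiltonianC (G d L) (piFluxAmpl κ) U g g' h B]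
  rw [Finset.mul_sum, ← Finset.sum_add_distrib]
  refine Finset.sum_congr rfl fun x _ => ?_
  have hS : (gibbsState β H' (∑ y : FermionTorus (d + 1) L,
      if (G d L).Adj x y then gammaThree x * gammaThree y else 0)).re =
      ∑ y : FermionTorus (d + 1) L,
        (if (G d L).Adj x y then (gibbsState β H' (gammaThree x * gammaThree y)).re else 0) := by
    rw [map_sum, Complex.re_sum]
    refine Finset.sum_congr rfl fun y _ => ?_
    split_ifs
    · rfl
    · rw [map_zero, Complex.zero_re]
  rw [map_add, Complex.add_re, map_smul, smul_eq_mul, Complex.re_ofReal_mul, hS]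

/-- The number of ordered nearest-neighbour pairs of the torus: `Σ_x Σ_y [x∼y] = 2(d+1)L^{d+1}`
(`2D` neighbours per site, `L ≥ 3`). [cite: Koma2022, (6.29), (6.33)] -/
theorem sum_adj_indicator_eq (h3 : 3 ≤ L) :
    ∑ x : FermionTorus (d + 1) L, ∑ y : FermionTorus (d + 1) L, (if (G d L).Adj x y then (1 : ℝ) else 0) =
      2 * (d + 1) * (L : ℝ) ^ (d + 1) := by
  rw [← sum_shift_add_sum_shift_swap h3 (fun (_ _ : FermionTorus (d + 1) L) => (1 : ℝ))]
  rw [Finset.sum_const, Finset.sum_const, Finset.card_univ, Finset.card_univ, Fintype.card_fin, nsmul_eq_mul,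
    nsmul_eq_mul, Nat.cast_add, Nat.cast_one]
  rw [show (Fintype.card (FermionTorus (d + 1) L) : ℝ) = (L : ℝ) ^ (d + 1) by
    simp only [FermionTorus, Fintype.card_lex, Fintype.card_fun, Fintype.card_fin, Nat.cast_pow]]
  ring

/-- **Koma's (6.33) with the Coulomb term** (Lieb frame, `B = 0`, `h = 0`): for `H_C = H(κ,U;g,g',0;0)`
with `κ, g, g' ≥ 0`, `L ≥ 3`, in the Gibbs state of `H_C` and with the double commutators of `H_C`,
`Σ_p (doubleComm C_p + doubleComm S_p) ≤ (8κ + 4g + 8g')(d+1) L^{d+1} L^{d+1}`: the hopping part gives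
`8(d+1)κ` per site ((6.26)), the pair interaction `2g·Σ_{y∼x}Re⟨Γ²_xΓ²_y⟩ ≤ 4g(d+1)`, and the Coulomb
term `-4g'Σ_{y∼x}Re⟨Γ³_xΓ³_y⟩ ≤ 8g'(d+1)`. [cite: Koma2022, (6.33), §8] -/
theorem doubleComm_modes_sum_le_coulomb (h3 : 3 ≤ L) {β : ℝ} {κ : ℝ} (hκ : 0 ≤ κ) (U : ℝ) {g : ℝ} (hg : 0 ≤ g)
    {g' : ℝ} (hg' : 0 ≤ g') :
    ∑ p : TorusSite (d + 1) L,
        (doubleComm β (hamiltonianC κ U g g' (fun (_ _ : FermionTorus (d + 1) L) => (0 : ℝ)) 0) (gammaOneMode (cosWave p)) +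
          doubleComm β (hamiltonianC κ U g g' (fun (_ _ : FermionTorus (d + 1) L) => (0 : ℝ)) 0)
            (gammaOneMode (sinWave p))) ≤
      (8 * κ + 4 * g + 8 * g') * (d + 1) * (L : ℝ) ^ (d + 1) * (L : ℝ) ^ (d + 1) := by
  set H₀ := hamiltonianC κ U g g' (fun (_ _ : FermionTorus (d + 1) L) => (0 : ℝ)) 0 with hH₀
  have hH : H₀.IsHermitian := hamiltonianC_isHermitian κ U g g' _ 0
  rw [doubleComm_modes_sumRule]
  have hcount := sum_adj_indicator_eq (d := d) h3
  have hdiag : ∑ x : FermionTorus (d + 1) L, dcKernel β H₀ x x ≤ (8 * κ + 4 * g + 8 * g') * (d + 1) * (L : ℝ) ^ (d + 1) := by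
    unfold dcKernel
    rw [hH₀, sum_dcKernel_diag_hamiltonianC_eq, sum_dcKernel_diag_eq, mul_zero, zero_mul, add_zero, ← hH₀]
    have hK := sum_re_gibbsState_doubleComm_hopping_le (d := d) h3 hκ β hH
    have hP : ∑ x : FermionTorus (d + 1) L, ∑ y : FermionTorus (d + 1) L,
        (if (G d L).Adj x y then (gibbsState β H₀ (gammaTwo x * gammaTwo y)).re else 0) ≤
        2 * (d + 1) * (L : ℝ) ^ (d + 1) := by
      rw [← hcount]
      refine Finset.sum_le_sum fun x _ => Finset.sum_le_sum fun y _ => ?_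
      split_ifs
      · exact re_gibbsState_gammaTwo_mul_le_one β hH x y
      · exact le_rfl
    have hQ : -(2 * (d + 1) * (L : ℝ) ^ (d + 1)) ≤ ∑ x : FermionTorus (d + 1) L, ∑ y : FermionTorus (d + 1) L,
        (if (G d L).Adj x y then (gibbsState β H₀ (gammaThree x * gammaThree y)).re else 0) := by
      rw [← hcount, ← Finset.sum_neg_distrib]
      refine Finset.sum_le_sum fun x _ => ?_
      rw [← Finset.sum_neg_distrib]
      refine Finset.sum_le_sum fun y _ => ?_
      split_ifs
      · exact neg_one_le_re_gibbsState_gammaThree_mul β hH x y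
      · rw [neg_zero]
    nlinarith [hK, hP, hQ, hg, hg']
  have hLpos : (0 : ℝ) ≤ (L : ℝ) ^ (d + 1) := by positivity
  calc (L : ℝ) ^ (d + 1) * ∑ x : FermionTorus (d + 1) L, dcKernel β H₀ x x
      ≤ (L : ℝ) ^ (d + 1) * ((8 * κ + 4 * g + 8 * g') * (d + 1) * (L : ℝ) ^ (d + 1)) := by gcongr
    _ = (8 * κ + 4 * g + 8 * g') * (d + 1) * (L : ℝ) ^ (d + 1) * (L : ℝ) ^ (d + 1) := by ring

/-- The nearest-neighbour `Γ²` correlation sum over ordered adjacent pairs is twice the directed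
nearest-neighbour `Γ¹` correlation sum, with the Coulomb term. [cite: Koma2022, (6.31), §8] -/
theorem sum_adj_re_gibbsState_gammaTwo_mul_coulomb (h3 : 3 ≤ L) (β κ U g g' : ℝ) :
    ∑ x : FermionTorus (d + 1) L, ∑ y : FermionTorus (d + 1) L,
        (if (G d L).Adj x y then (gibbsState β (hamiltonianC κ U g g' (fun (_ _ : FermionTorus (d + 1) L) => (0 : ℝ)) 0)
          (gammaTwo x * gammaTwo y)).re else 0) =
      2 * ∑ i : Fin (d + 1), ∑ x : FermionTorus (d + 1) L,
        pairCorr β (hamiltonianC κ U g g' (fun (_ _ : FermionTorus (d + 1) L) => (0 : ℝ)) 0) x (shift x i) := by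
  set H₀ := hamiltonianC κ U g g' (fun (_ _ : FermionTorus (d + 1) L) => (0 : ℝ)) 0 with hH₀
  have hrot : ∀ x y : FermionTorus (d + 1) L, (gibbsState β H₀ (gammaTwo x * gammaTwo y)).re = pairCorr β H₀ x y := by
    intro x y
    rw [pairCorr, hH₀]
    unfold hamiltonianC
    rw [PairHopRP.gibbsState_gammaOne_mul_eq_coulomb]
  have hsymm : ∀ x y : FermionTorus (d + 1) L, pairCorr β H₀ y x = pairCorr β H₀ x y := fun x y => pairCorr_symm β H₀ y x
  rw [← sum_shift_add_sum_shift_swap h3 (fun x y => (gibbsState β H₀ (gammaTwo x * gammaTwo y)).re)]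
  simp_rw [hrot, hsymm, ← two_mul]
  rw [Finset.sum_comm, Finset.mul_sum]
  refine Finset.sum_congr rfl fun i _ => ?_
  rw [Finset.mul_sum]

omit [NeZero L] in
/-- `Re⟨A²⟩ ≥ 0` for Hermitian `A` in any Gibbs state. [cite: BratteliRobinson1997, §5.3.1] -/
private theorem re_gibbsState_sq_nonneg' (β : ℝ)
    {H : Matrix (Finset (Orb (FermionTorus (d + 1) L))) (Finset (Orb (FermionTorus (d + 1) L))) ℂ} (hH : H.IsHermitian)
    {A : Matrix (Finset (Orb (FermionTorus (d + 1) L))) (Finset (Orb (FermionTorus (d + 1) L))) ℂ} (hA : A.IsHermitian) :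
    0 ≤ (gibbsState β H (A * A)).re := by
  have hP : (A * A).PosSemidef := by
    nth_rw 1 [← hA.eq]
    exact Matrix.posSemidef_conjTranspose_mul_self A
  exact (Complex.nonneg_iff.mp (gibbsState_nonneg_of_posSemidef β hH hP)).1

/-- **Koma's long-range-order inequality (6.34) with the Coulomb term, finite volume** (Lieb frame,
`B = 0`, `h = 0`, `κ ≥ 0`, `g > 0`, `g' ≥ 0`, even `L ≥ 4`): with `H_C = H(κ,U;g,g',0;0)`,
`N₁ = Σ_i Σ_x Re⟨Γ¹_xΓ¹_{x+e_i}⟩_β`, `|Λ| = L^{d+1}`: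
`|Λ| N₁ ≤ (d+1)|Λ|² m² + (|Λ|/(βg)) Σ_{q≠0}{C_q}₊/E_q + ½ √((|Λ|/g) Σ_{q≠0}{C_q}₊²/E_q) √(|Λ|(8(d+1)(κ+g')|Λ| + 4g N₁))`.
[cite: Koma2022, (6.17)–(6.24), (6.33)–(6.34), §8 (8.1)–(8.4)] -/
theorem koma_kls_coulomb (hL : Even L) (h4 : 4 ≤ L) {β : ℝ} (hβ : 0 < β) {κ : ℝ} (hκ : 0 ≤ κ) (U : ℝ) {g : ℝ}
    (hg : 0 < g) {g' : ℝ} (hg' : 0 ≤ g') :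
    (L : ℝ) ^ (d + 1) * ∑ i : Fin (d + 1), ∑ x : FermionTorus (d + 1) L,
        pairCorr β (hamiltonianC κ U g g' (fun (_ _ : FermionTorus (d + 1) L) => (0 : ℝ)) 0) x (shift x i) ≤
      (Fintype.card (FermionTorus (d + 1) L) : ℝ) ^ 2 *
          lroSq β (hamiltonianC κ U g g' (fun (_ _ : FermionTorus (d + 1) L) => (0 : ℝ)) 0) * (d + 1) +
        (L : ℝ) ^ (d + 1) / (β * g) * ∑ q ∈ (univ : Finset (TorusSite (d + 1) L)).erase 0,
          max (torusCosSum L q) 0 / dispersion (latticeMomentum L q) +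
        1 / 2 * Real.sqrt ((L : ℝ) ^ (d + 1) / g * ∑ q ∈ (univ : Finset (TorusSite (d + 1) L)).erase 0,
          (max (torusCosSum L q) 0) ^ 2 / dispersion (latticeMomentum L q)) *
          Real.sqrt ((L : ℝ) ^ (d + 1) * (8 * (d + 1) * (κ + g') * (L : ℝ) ^ (d + 1) +
            4 * g * ∑ i : Fin (d + 1), ∑ x : FermionTorus (d + 1) L,
              pairCorr β (hamiltonianC κ U g g' (fun (_ _ : FermionTorus (d + 1) L) => (0 : ℝ)) 0) x (shift x i))) := by
  have h3 : 3 ≤ L := by omega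
  set H₀ := hamiltonianC κ U g g' (fun (_ _ : FermionTorus (d + 1) L) => (0 : ℝ)) 0 with hH₀
  have hH : H₀.IsHermitian := hamiltonianC_isHermitian κ U g g' _ 0
  set N₁ := ∑ i : Fin (d + 1), ∑ x : FermionTorus (d + 1) L, pairCorr β H₀ x (shift x i) with hN₁
  -- the data of the abstract step
  set Gq : TorusSite (d + 1) L → ℝ := fun q =>
    (gibbsState β H₀ (gammaOneMode (cosWave q) * gammaOneMode (cosWave q))).re +
      (gibbsState β H₀ (gammaOneMode (sinWave q) * gammaOneMode (sinWave q))).re with hGq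
  set cq : TorusSite (d + 1) L → ℝ := fun q =>
    doubleComm β H₀ (gammaOneMode (cosWave q)) + doubleComm β H₀ (gammaOneMode (sinWave q)) with hcq
  have hG : ∀ q : TorusSite (d + 1) L, q ≠ 0 → 0 ≤ Gq q := fun q _ =>
    add_nonneg (re_gibbsState_sq_nonneg' β hH (gammaOneMode_isHermitian _))
      (re_gibbsState_sq_nonneg' β hH (gammaOneMode_isHermitian _))
  have hc : ∀ q : TorusSite (d + 1) L, 0 ≤ cq q := fun q =>
    add_nonneg (doubleComm_nonneg_coulomb hβ.le κ U g g' _ 0 (gammaOneMode_isHermitian _))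
      (doubleComm_nonneg_coulomb hβ.le κ U g g' _ 0 (gammaOneMode_isHermitian _))
  have hIR : ∀ q : TorusSite (d + 1) L, q ≠ 0 →
      Gq q ≤ (L : ℝ) ^ (d + 1) / (β * g * dispersion (latticeMomentum L q)) +
        1 / 2 * Real.sqrt (β * ((L : ℝ) ^ (d + 1) / (β * g * dispersion (latticeMomentum L q))) * cq q) :=
    fun q hq => gibbs_modes_le_coulomb hL h4 hβ hκ U hg hg' 0 (dispersion_latticeMomentum_pos hq)
  -- (DC): `Σ_q c_q ≤ |Λ| (8(d+1)(κ+g')|Λ| + 4g N₁)`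
  have hDC : ∑ q : TorusSite (d + 1) L, cq q ≤
      (L : ℝ) ^ (d + 1) * (8 * (d + 1) * (κ + g') * (L : ℝ) ^ (d + 1) + 4 * g * N₁) := by
    have hsum := doubleComm_modes_sumRule β H₀
    simp only [hcq]
    rw [hsum]
    refine mul_le_mul_of_nonneg_left ?_ (by positivity)
    unfold dcKernel
    rw [hH₀, sum_dcKernel_diag_hamiltonianC_eq, sum_dcKernel_diag_eq, mul_zero, zero_mul, add_zero,
      sum_adj_re_gibbsState_gammaTwo_mul_coulomb h3, ← hH₀]
    have hK := sum_re_gibbsState_doubleComm_hopping_le (d := d) h3 hκ β hH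
    have hQ : -(2 * (d + 1) * (L : ℝ) ^ (d + 1)) ≤ ∑ x : FermionTorus (d + 1) L, ∑ y : FermionTorus (d + 1) L,
        (if (G d L).Adj x y then (gibbsState β H₀ (gammaThree x * gammaThree y)).re else 0) := by
      rw [← sum_adj_indicator_eq (d := d) h3, ← Finset.sum_neg_distrib]
      refine Finset.sum_le_sum fun x _ => ?_
      rw [← Finset.sum_neg_distrib]
      refine Finset.sum_le_sum fun y _ => ?_
      split_ifs
      · exact neg_one_le_re_gibbsState_gammaThree_mul β hH x y
      · rw [neg_zero]
    nlinarith [hK, hQ, hg, hg']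
  -- (SR): the weighted sum rule summed over the directions, split at `q = 0`
  have hSR : ∑ q ∈ (univ : Finset (TorusSite (d + 1) L)).erase 0, Gq q * torusCosSum L q +
      (Fintype.card (FermionTorus (d + 1) L) : ℝ) ^ 2 * lroSq β H₀ * torusCosSum L (0 : TorusSite (d + 1) L) =
      (L : ℝ) ^ (d + 1) * N₁ := by
    rw [modes_sum_split β H₀ (torusCosSum L)]
    simp only [torusCosSum, Finset.mul_sum, hN₁]
    rw [Finset.sum_comm]
    refine Finset.sum_congr rfl fun i _ => ?_
    rw [← Finset.mul_sum, ← modes_weightedSumRule β H₀ i]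
  have key := koma_kls_abstract Gq cq hβ hg (by positivity : (0 : ℝ) ≤ (L : ℝ) ^ (d + 1)) hG hc hIR hDC hSR
  linarith [key]

end KomaPiFlux

end Literature.MathematicalPhysics.QuantumLattice

end
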